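import Literature.NumberTheory.LFunctions.HeckeGaussianFourier
import HarnessLib

/-!
# The Fourier transform of `(⟨x, e₁⟩ + i⟨x, e₂⟩)^m e^{-π‖x‖²}`: harmonic weights at a COMPLEX place

Topic `Literature/NumberTheory/LFunctions` (companion of `HeckeGaussianFourier.lean`, whose case of products of
DISTINCT orthogonal real linear forms — the sign weights `N(x^p)` at real places — it complements); namespace
`Literature.NumberTheory.LFunctions.Fourier`.

On a finite-dimensional real inner product space `V`, for two orthogonal vectors `e₁, e₂` OF THE SAME LENGTH, the
complex-valued linear form `ℓ(x) = ⟨x, e₁⟩ + i⟨x, e₂⟩` has harmonic powers `ℓ^m` (`m ≥ 0`), and the multiple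
`ℓ(x)^m G(x)` of the Gaussian `G(x) = e^{-π‖x‖²}` is an eigenfunction of the Fourier transform
(`𝓕 f(ξ) = ∫ f(x) e^{-2πi⟨x,ξ⟩} dx`):

  `𝓕[ℓ^m G] = (-i)^m ℓ^m G`        (`fourier_cpowGaussian`),

and for the translate, `𝓕[ℓ^m G(· + x₀)](ξ) = e^{2πi⟨x₀, ξ⟩} (-i)^m ℓ(ξ)^m G(ξ)` (`fourier_cpowGaussian_add`).

This is the analytic input of Hecke's theta transformation formula with the Größencharakter weight `σ(x)^m` at a
COMPLEX place `σ` (Hecke 1920; Neukirch, *Algebraic Number Theory*, VII (3.3) Proposition: the functions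
`f_p(a, b, x) = N((x+a)^p) e^{-π⟨a+x,a+x⟩ + 2πi⟨b,x⟩}` satisfy `f̂ = [i^{Tr(p)} e^{2πi⟨a,b⟩}]⁻¹ f_p(-b, a, ·)` for every
ADMISSIBLE `p` — at a complex place `τ` admissibility means `p_τ p_τ̄ = 0`, i.e. the weight is `x_τ^m` or `x̄_τ^m`,
exactly the harmonic powers `ℓ^m`, `ℓ̄^m`; in the euclidean model of `K_ℝ` the coordinate `x_τ` IS
`⟨x, E_{τ,1}⟩ + i⟨x, E_{τ,i}⟩` for the two unit vectors of the place `τ`).  The sibling file treats the real places; this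
file is what the functional equation of the `L`-series of a Größencharakter of type `(m, 0)` of an imaginary quadratic
field needs (de Shalit 1987 II.1.1; used by `HeckeThetaInversionComplexWeight.lean`).

## Proof

Induction on `m`, as in the sibling file but with the COMPLEX directional derivative `D = ∂_{e₁} + i ∂_{e₂}`: if
`𝓕 f = c f` for `f = ℓ^m G`, then `D(𝓕 f)(ξ) = 𝓕[-2πi ℓ f](ξ) = -2πi 𝓕[ℓ^{m+1} G](ξ)` (Mathlib
`Real.hasFDerivAt_fourier`), while `D f = m ℓ^{m-1} (D ℓ) G + ℓ^m (D G)` with `D ℓ = ‖e₁‖² - ‖e₂‖² + 2i⟨e₁,e₂⟩ = 0`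
(this is where `e₁ ⊥ e₂`, `‖e₁‖ = ‖e₂‖` enter: `ℓ` is "holomorphic") and `D G = -2π ℓ G`; hence
`𝓕[ℓ^{m+1} G] = (-i) c ℓ^{m+1} G`.

## Mathlib / tree search

Mathlib (this pin): `fourier_gaussian_innerProductSpace'` (Gaussian with a linear phase, no polynomial weight),
`Real.hasFDerivAt_fourier`, `fourierSMulRight`, `Real.fourier_continuousLinearMap_apply`; no Hermite / harmonic-polynomial
transforms.  Tree: `Fourier.fourier_polyGaussian(_add)` (products of distinct orthogonal REAL forms only — a repeated real
form `⟨x,e⟩²` is not harmonic and is NOT an eigenfunction), `Fourier.hasDerivAt_gaussian_add_smul`,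
`Fourier.norm_pow_mul_exp_le`, `Fourier.integrable_norm_pow_mul_exp`, `Fourier.one_add_norm_add_rpow_neg_le`,
`NumberField.fourier_gaussian_pi_eq_self` — all reused.  `lean search 'cpowGaussian|complex.*Gaussian.*fourier'`: nothing.

## References

* J. Neukirch, *Algebraic Number Theory*, Grundlehren 322, Springer 1999, Ch. VII §3, (3.1) and (3.3) Proposition
  (admissible `p`, complex places). [NeukirchANT1999]
* E. Hecke, *Eine neue Art von Zetafunktionen und ihre Beziehungen zur Verteilung der Primzahlen II*, Math. Z. 6
  (1920), 11–51. [HeckeMathZ1920]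
-/

noncomputable section

open MeasureTheory VectorFourier
open scoped FourierTransform RealInnerProductSpace Real

namespace Literature.NumberTheory.LFunctions.Fourier

variable {V : Type*} [NormedAddCommGroup V] [InnerProductSpace ℝ V] [FiniteDimensional ℝ V]
  [MeasurableSpace V] [BorelSpace V]

/-! ### The complex linear form `ℓ(x) = ⟨x, e₁⟩ + i⟨x, e₂⟩` and the functions `ℓ^m G` -/

/-- The **complex-valued linear form `ℓ(x) = ⟨x, e₁⟩ + i ⟨x, e₂⟩`** attached to a pair of vectors (in Hecke's
application `e₁, e₂` are the unit vectors `1, i` of a complex place `τ` of the Minkowski space and `ℓ(x) = x_τ`).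
Ref: Neukirch, *Algebraic Number Theory*, Ch. VII §3, the coordinates `x_τ` of `K_ℝ`. [folklore] -/
def cLin (e₁ e₂ : V) (v : V) : ℂ :=
  ((⟪v, e₁⟫ : ℝ) : ℂ) + ((⟪v, e₂⟫ : ℝ) : ℂ) * Complex.I

omit [FiniteDimensional ℝ V] [MeasurableSpace V] [BorelSpace V] in
/-- Unfolding lemma for `cLin`. [cite: NeukirchANT1999, Ch. VII §3 (3.1)–(3.3) (proof steps)] -/
theorem cLin_apply (e₁ e₂ v : V) :
    cLin e₁ e₂ v = ((⟪v, e₁⟫ : ℝ) : ℂ) + ((⟪v, e₂⟫ : ℝ) : ℂ) * Complex.I := rfl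

omit [FiniteDimensional ℝ V] [MeasurableSpace V] [BorelSpace V] in
/-- `ℓ` is additive. [cite: NeukirchANT1999, Ch. VII §3 (3.1)–(3.3) (proof steps)] -/
theorem cLin_add (e₁ e₂ v w : V) : cLin e₁ e₂ (v + w) = cLin e₁ e₂ v + cLin e₁ e₂ w := by
  simp only [cLin_apply, inner_add_left]
  push_cast
  ring

omit [FiniteDimensional ℝ V] [MeasurableSpace V] [BorelSpace V] in
/-- `ℓ` is real-homogeneous. [cite: NeukirchANT1999, Ch. VII §3 (3.1)–(3.3) (proof steps)] -/
theorem cLin_smul (e₁ e₂ : V) (t : ℝ) (v : V) : cLin e₁ e₂ (t • v) = (t : ℂ) * cLin e₁ e₂ v := by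
  simp only [cLin_apply, real_inner_smul_left]
  push_cast
  ring

omit [FiniteDimensional ℝ V] [MeasurableSpace V] [BorelSpace V] in
/-- Along a line: `ℓ(w + t u) = ℓ(w) + t ℓ(u)`. [cite: NeukirchANT1999, Ch. VII §3 (3.1)–(3.3) (proof steps)] -/
theorem cLin_add_smul (e₁ e₂ w u : V) (t : ℝ) :
    cLin e₁ e₂ (w + t • u) = cLin e₁ e₂ w + (t : ℂ) * cLin e₁ e₂ u := by
  rw [cLin_add, cLin_smul]

omit [FiniteDimensional ℝ V] [MeasurableSpace V] [BorelSpace V] in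
/-- `|ℓ(v)| ≤ (‖e₁‖ + ‖e₂‖) ‖v‖` (Cauchy–Schwarz). [cite: NeukirchANT1999, Ch. VII §3 (3.1)–(3.3) (proof steps)] -/
theorem norm_cLin_le (e₁ e₂ v : V) : ‖cLin e₁ e₂ v‖ ≤ (‖e₁‖ + ‖e₂‖) * ‖v‖ := by
  rw [cLin_apply]
  calc ‖((⟪v, e₁⟫ : ℝ) : ℂ) + ((⟪v, e₂⟫ : ℝ) : ℂ) * Complex.I‖
      ≤ ‖((⟪v, e₁⟫ : ℝ) : ℂ)‖ + ‖((⟪v, e₂⟫ : ℝ) : ℂ) * Complex.I‖ := norm_add_le _ _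
    _ = |⟪v, e₁⟫| + |⟪v, e₂⟫| := by
        rw [norm_mul, Complex.norm_I, mul_one, Complex.norm_real, Complex.norm_real, Real.norm_eq_abs,
          Real.norm_eq_abs]
    _ ≤ ‖v‖ * ‖e₁‖ + ‖v‖ * ‖e₂‖ := add_le_add (abs_real_inner_le_norm v e₁) (abs_real_inner_le_norm v e₂)
    _ = (‖e₁‖ + ‖e₂‖) * ‖v‖ := by ring

omit [FiniteDimensional ℝ V] [MeasurableSpace V] [BorelSpace V] in
/-- `ℓ` is continuous. [cite: NeukirchANT1999, Ch. VII §3 (3.1)–(3.3) (proof steps)] -/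
theorem continuous_cLin (e₁ e₂ : V) : Continuous (cLin e₁ e₂) := by
  unfold cLin
  exact ((Complex.continuous_ofReal.comp (continuous_id.inner continuous_const)).add
    ((Complex.continuous_ofReal.comp (continuous_id.inner continuous_const)).mul continuous_const))

omit [FiniteDimensional ℝ V] [MeasurableSpace V] [BorelSpace V] in
/-- **The "holomorphy" of `ℓ`: `ℓ(e₁) + i ℓ(e₂) = 0` for `e₁ ⊥ e₂` of the same length** (this is
`(∂_{e₁} + i∂_{e₂}) ℓ = ‖e₁‖² - ‖e₂‖² + 2i⟨e₁, e₂⟩`). [cite: NeukirchANT1999, Ch. VII §3 (3.1)–(3.3) (proof steps)] -/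
theorem cLin_self_add_I_mul_cLin_self {e₁ e₂ : V} (h12 : ⟪e₁, e₂⟫ = 0) (hnorm : ‖e₁‖ = ‖e₂‖) :
    cLin e₁ e₂ e₁ + Complex.I * cLin e₁ e₂ e₂ = 0 := by
  rw [cLin_apply, cLin_apply, real_inner_comm e₁ e₂, h12, real_inner_self_eq_norm_sq,
    real_inner_self_eq_norm_sq, hnorm]
  push_cast
  have hI : Complex.I * Complex.I = -1 := Complex.I_mul_I
  linear_combination ((‖e₂‖ : ℂ) ^ 2) * hI

/-- The **harmonic multiple `ℓ(x)^m G(x)` of the Gaussian `G(x) = e^{-π‖x‖²}`**, `ℓ(x) = ⟨x, e₁⟩ + i⟨x, e₂⟩`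
(Neukirch's `f_p(0, 0, x) = N(x^p) e^{-π⟨x,x⟩}` for the admissible exponent `p` supported at ONE complex place with
`p_τ = m`, `p_τ̄ = 0`).  Ref: Neukirch, *Algebraic Number Theory*, Ch. VII §3, the functions `f_p(a, b, x)` before (3.3).
[cite: NeukirchANT1999, Ch. VII §3 (3.3) Proposition] -/
def cpowGaussian (e₁ e₂ : V) (m : ℕ) (v : V) : ℂ :=
  cLin e₁ e₂ v ^ m * ((Real.exp (-π * ‖v‖ ^ 2) : ℝ) : ℂ)

omit [FiniteDimensional ℝ V] [MeasurableSpace V] [BorelSpace V] in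
/-- Unfolding lemma for `cpowGaussian`. [cite: NeukirchANT1999, Ch. VII §3 (3.1)–(3.3) (proof steps)] -/
theorem cpowGaussian_apply (e₁ e₂ : V) (m : ℕ) (v : V) :
    cpowGaussian e₁ e₂ m v = cLin e₁ e₂ v ^ m * ((Real.exp (-π * ‖v‖ ^ 2) : ℝ) : ℂ) := rfl

omit [FiniteDimensional ℝ V] [MeasurableSpace V] [BorelSpace V] in
/-- With exponent `0`, `ℓ^0 G = G`. [cite: NeukirchANT1999, Ch. VII §3 (3.1)–(3.3) (proof steps)] -/
theorem cpowGaussian_zero (e₁ e₂ : V) :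
    cpowGaussian e₁ e₂ 0 = fun v ↦ ((Real.exp (-π * ‖v‖ ^ 2) : ℝ) : ℂ) := by
  funext v; rw [cpowGaussian_apply, pow_zero, one_mul]

omit [FiniteDimensional ℝ V] [MeasurableSpace V] [BorelSpace V] in
/-- Raising the exponent: `ℓ^{m+1} G = ℓ · ℓ^m G`. [cite: NeukirchANT1999, Ch. VII §3 (3.1)–(3.3) (proof steps)] -/
theorem cpowGaussian_succ (e₁ e₂ : V) (m : ℕ) (v : V) :
    cpowGaussian e₁ e₂ (m + 1) v = cLin e₁ e₂ v * cpowGaussian e₁ e₂ m v := by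
  rw [cpowGaussian_apply, cpowGaussian_apply, pow_succ]; ring

omit [FiniteDimensional ℝ V] [MeasurableSpace V] [BorelSpace V] in
/-- `ℓ^m G` is continuous. [cite: NeukirchANT1999, Ch. VII §3 (3.1)–(3.3) (proof steps)] -/
theorem continuous_cpowGaussian (e₁ e₂ : V) (m : ℕ) : Continuous (cpowGaussian e₁ e₂ m) := by
  unfold cpowGaussian
  exact ((continuous_cLin e₁ e₂).pow m).mul (by fun_prop)

omit [FiniteDimensional ℝ V] [MeasurableSpace V] [BorelSpace V] in
/-- `|ℓ(x)^m G(x)| ≤ (‖e₁‖ + ‖e₂‖)^m ‖x‖^m e^{-π‖x‖²}`. [cite: NeukirchANT1999, Ch. VII §3 (3.1)–(3.3) (proof steps)] -/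
theorem norm_cpowGaussian_le (e₁ e₂ : V) (m : ℕ) (v : V) :
    ‖cpowGaussian e₁ e₂ m v‖ ≤ (‖e₁‖ + ‖e₂‖) ^ m * (‖v‖ ^ m * Real.exp (-π * ‖v‖ ^ 2)) := by
  rw [cpowGaussian_apply, norm_mul, Complex.norm_real, Real.norm_eq_abs, abs_of_pos (Real.exp_pos _),
    norm_pow, ← mul_assoc, ← mul_pow]
  refine mul_le_mul_of_nonneg_right ?_ (Real.exp_pos _).le
  exact pow_le_pow_left₀ (norm_nonneg _) (norm_cLin_le e₁ e₂ v) m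

/-- `ℓ^m G` is integrable. [cite: NeukirchANT1999, Ch. VII §3 (3.1)–(3.3) (proof steps)] -/
theorem integrable_cpowGaussian (e₁ e₂ : V) (m : ℕ) : Integrable (cpowGaussian e₁ e₂ m) :=
  ((integrable_norm_pow_mul_exp m).const_mul ((‖e₁‖ + ‖e₂‖) ^ m)).mono'
    (continuous_cpowGaussian e₁ e₂ m).aestronglyMeasurable
    (Filter.Eventually.of_forall (norm_cpowGaussian_le e₁ e₂ m))

/-- `‖x‖ · |ℓ(x)^m G(x)|` is integrable (the hypothesis of `Real.hasFDerivAt_fourier`). [cite: NeukirchANT1999, Ch. VII §3 (3.1)–(3.3) (proof steps)] -/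
theorem integrable_norm_mul_norm_cpowGaussian (e₁ e₂ : V) (m : ℕ) :
    Integrable fun v : V ↦ ‖v‖ * ‖cpowGaussian e₁ e₂ m v‖ := by
  refine ((integrable_norm_pow_mul_exp (m + 1)).const_mul ((‖e₁‖ + ‖e₂‖) ^ m)).mono'
    (continuous_norm.mul (continuous_cpowGaussian e₁ e₂ m).norm).aestronglyMeasurable
    (Filter.Eventually.of_forall fun v ↦ ?_)
  rw [Real.norm_eq_abs, abs_of_nonneg (by positivity)]
  calc ‖v‖ * ‖cpowGaussian e₁ e₂ m v‖
      ≤ ‖v‖ * ((‖e₁‖ + ‖e₂‖) ^ m * (‖v‖ ^ m * Real.exp (-π * ‖v‖ ^ 2))) :=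
        mul_le_mul_of_nonneg_left (norm_cpowGaussian_le e₁ e₂ m v) (norm_nonneg v)
    _ = (‖e₁‖ + ‖e₂‖) ^ m * (‖v‖ ^ (m + 1) * Real.exp (-π * ‖v‖ ^ 2)) := by ring

/-- The integrand `-2πi ⟨x, ·⟩ ℓ(x)^m G(x)` of the derivative of `𝓕[ℓ^m G]` is integrable. [cite: NeukirchANT1999, Ch. VII §3 (3.1)–(3.3) (proof steps)] -/
theorem integrable_fourierSMulRight_cpowGaussian (e₁ e₂ : V) (m : ℕ) :
    Integrable (fourierSMulRight (innerSL ℝ) (cpowGaussian e₁ e₂ m)) := by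
  refine ((integrable_norm_mul_norm_cpowGaussian e₁ e₂ m).const_mul
    (2 * π * ‖innerSL ℝ (E := V)‖)).mono'
    (continuous_cpowGaussian e₁ e₂ m).aestronglyMeasurable.fourierSMulRight
    (Filter.Eventually.of_forall fun v ↦ ?_)
  calc ‖fourierSMulRight (innerSL ℝ) (cpowGaussian e₁ e₂ m) v‖
      ≤ 2 * π * ‖innerSL ℝ (E := V)‖ * ‖v‖ * ‖cpowGaussian e₁ e₂ m v‖ := norm_fourierSMulRight_le _ _ _
    _ = 2 * π * ‖innerSL ℝ (E := V)‖ * (‖v‖ * ‖cpowGaussian e₁ e₂ m v‖) := by ring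

/-- A single coordinate `x ↦ -2πi ⟨x, u⟩ ℓ(x)^m G(x)` of that integrand is integrable. [cite: NeukirchANT1999, Ch. VII §3 (3.1)–(3.3) (proof steps)] -/
theorem integrable_fourierSMulRight_cpowGaussian_apply (e₁ e₂ : V) (m : ℕ) (u : V) :
    Integrable fun v : V ↦ fourierSMulRight (innerSL ℝ) (cpowGaussian e₁ e₂ m) v u := by
  refine ((integrable_fourierSMulRight_cpowGaussian e₁ e₂ m).norm.mul_const ‖u‖).mono'
    ((ContinuousLinearMap.apply ℝ ℂ u).continuous.comp_aestronglyMeasurable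
      (continuous_cpowGaussian e₁ e₂ m).aestronglyMeasurable.fourierSMulRight)
    (Filter.Eventually.of_forall fun v ↦ ContinuousLinearMap.le_opNorm _ _)

/-! ### The directional derivatives of `ℓ^m G` -/

omit [FiniteDimensional ℝ V] [MeasurableSpace V] [BorelSpace V] in
/-- **`∂_u (ℓ^m G)(w) = m ℓ(w)^{m-1} ℓ(u) G(w) - 2π ⟨w, u⟩ ℓ(w)^m G(w)`**: the derivative at `t = 0` of
`t ↦ ℓ(w + tu)^m G(w + tu) = (ℓ(w) + t ℓ(u))^m G(w + tu)`. [cite: NeukirchANT1999, Ch. VII §3 (3.1)–(3.3) (proof steps)] -/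
theorem hasDerivAt_cpowGaussian_add_smul (e₁ e₂ : V) (m : ℕ) (w u : V) :
    HasDerivAt (fun t : ℝ ↦ cpowGaussian e₁ e₂ m (w + t • u))
      ((m : ℂ) * cLin e₁ e₂ w ^ (m - 1) * cLin e₁ e₂ u * ((Real.exp (-π * ‖w‖ ^ 2) : ℝ) : ℂ) +
        cLin e₁ e₂ w ^ m * (((-(2 * π * ⟪w, u⟫) : ℝ) : ℂ) * ((Real.exp (-π * ‖w‖ ^ 2) : ℝ) : ℂ))) 0 := by
  -- the polynomial factor `(ℓ(w) + t ℓ(u))^m`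
  have hlin : HasDerivAt (fun t : ℝ ↦ cLin e₁ e₂ w + (t : ℂ) * cLin e₁ e₂ u) (cLin e₁ e₂ u) 0 := by
    have h := ((Complex.ofRealCLM.hasDerivAt (x := (0 : ℝ))).mul_const (cLin e₁ e₂ u)).const_add
      (cLin e₁ e₂ w)
    simpa using h
  have hpow : HasDerivAt (fun t : ℝ ↦ (cLin e₁ e₂ w + (t : ℂ) * cLin e₁ e₂ u) ^ m)
      ((m : ℂ) * (cLin e₁ e₂ w + ((0 : ℝ) : ℂ) * cLin e₁ e₂ u) ^ (m - 1) * cLin e₁ e₂ u) 0 :=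
    (hasDerivAt_pow m (cLin e₁ e₂ w + ((0 : ℝ) : ℂ) * cLin e₁ e₂ u)).comp (0 : ℝ) hlin
  have hG := hasDerivAt_gaussian_add_smul w u
  have hprod := hpow.mul hG
  have heq : (fun t : ℝ ↦ cpowGaussian e₁ e₂ m (w + t • u)) =
      fun t : ℝ ↦ (cLin e₁ e₂ w + (t : ℂ) * cLin e₁ e₂ u) ^ m *
        ((Real.exp (-π * ‖w + t • u‖ ^ 2) : ℝ) : ℂ) := by
    funext t; rw [cpowGaussian_apply, cLin_add_smul]
  rw [heq]
  refine hprod.congr_deriv ?_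
  simp only [Complex.ofReal_zero, zero_mul, add_zero, zero_smul]

/-! ### The Fourier transform of `ℓ^m G` -/

/-- **`𝓕[ℓ^m G] = (-i)^m ℓ^m G` for `ℓ(x) = ⟨x, e₁⟩ + i⟨x, e₂⟩` with `e₁ ⊥ e₂`, `‖e₁‖ = ‖e₂‖`** — Neukirch VII
(3.3) Proposition, `f̂_p(a, b, ·) = [i^{Tr(p)} e^{2πi⟨a,b⟩}]⁻¹ f_p(-b, a, ·)`, in the case `a = b = 0`, on an abstract
euclidean space and for the admissible exponent `p` supported at one complex place (`p_τ = m`, `p_τ̄ = 0`: the harmonic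
weight `x_τ^m`).  Proof by induction on `m`, applying the complex directional derivative `∂_{e₁} + i∂_{e₂}` to
`𝓕[ℓ^m G] = (-i)^m ℓ^m G` (module docstring; Neukirch differentiates the case `p = 0` in `a`).
[cite: NeukirchANT1999, Ch. VII §3 (3.3) Proposition] -/
theorem fourier_cpowGaussian {e₁ e₂ : V} (h12 : ⟪e₁, e₂⟫ = 0) (hnorm : ‖e₁‖ = ‖e₂‖) (m : ℕ) :
    𝓕 (cpowGaussian e₁ e₂ m) = fun w ↦ (-Complex.I) ^ m * cpowGaussian e₁ e₂ m w := by
  induction m with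
  | zero =>
    funext w
    rw [cpowGaussian_zero, NumberField.fourier_gaussian_pi_eq_self, pow_zero, one_mul]
  | succ m ih =>
    set f := cpowGaussian e₁ e₂ m with hf
    funext w
    -- the Fréchet derivative of `𝓕 f = (-i)^m f` at `w`
    have hF : HasFDerivAt (fun w ↦ (-Complex.I) ^ m * f w)
        (𝓕 (fourierSMulRight (innerSL ℝ) f) w) w := by
      have := Real.hasFDerivAt_fourier (integrable_cpowGaussian e₁ e₂ m)
        (integrable_norm_mul_norm_cpowGaussian e₁ e₂ m) w
      rwa [ih] at this
    -- directional derivatives along `e₁` and `e₂`, each computed in two ways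
    have hdir : ∀ u : V, 𝓕 (fourierSMulRight (innerSL ℝ) f) w u =
        (-Complex.I) ^ m * ((m : ℂ) * cLin e₁ e₂ w ^ (m - 1) * cLin e₁ e₂ u *
            ((Real.exp (-π * ‖w‖ ^ 2) : ℝ) : ℂ) +
          cLin e₁ e₂ w ^ m * (((-(2 * π * ⟪w, u⟫) : ℝ) : ℂ) * ((Real.exp (-π * ‖w‖ ^ 2) : ℝ) : ℂ))) := by
      intro u
      have hline : HasDerivAt (fun t : ℝ ↦ w + t • u) u 0 := by
        simpa using ((hasDerivAt_id (0 : ℝ)).smul_const u).const_add w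
      have hD1 : HasDerivAt (fun t : ℝ ↦ (-Complex.I) ^ m * f (w + t • u))
          (𝓕 (fourierSMulRight (innerSL ℝ) f) w u) 0 :=
        hF.comp_hasDerivAt_of_eq (0 : ℝ) hline (by simp)
      have hD2 : HasDerivAt (fun t : ℝ ↦ (-Complex.I) ^ m * f (w + t • u))
          ((-Complex.I) ^ m * ((m : ℂ) * cLin e₁ e₂ w ^ (m - 1) * cLin e₁ e₂ u *
              ((Real.exp (-π * ‖w‖ ^ 2) : ℝ) : ℂ) +
            cLin e₁ e₂ w ^ m * (((-(2 * π * ⟪w, u⟫) : ℝ) : ℂ) * ((Real.exp (-π * ‖w‖ ^ 2) : ℝ) : ℂ)))) 0 :=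
        (hasDerivAt_cpowGaussian_add_smul e₁ e₂ m w u).const_mul _
      exact hD1.unique hD2
    -- each coordinate of the derivative is a Fourier integral
    have hcoord : ∀ u : V, 𝓕 (fourierSMulRight (innerSL ℝ) f) w u =
        𝓕 (fun x ↦ fourierSMulRight (innerSL ℝ) f x u) w := fun u ↦
      Real.fourier_continuousLinearMap_apply (integrable_fourierSMulRight_cpowGaussian e₁ e₂ m)
    -- the combination `∂_{e₁} + i ∂_{e₂}` of the integrands is `-2πi ℓ^{m+1} G`
    have hfun : (fun x ↦ fourierSMulRight (innerSL ℝ) f x e₁) + Complex.I • (fun x ↦ fourierSMulRight (innerSL ℝ) f x e₂) =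
        (-(2 * π * Complex.I)) • cpowGaussian e₁ e₂ (m + 1) := by
      funext x
      simp only [Pi.add_apply, Pi.smul_apply, smul_eq_mul]
      rw [fourierSMulRight_apply, fourierSMulRight_apply, innerSL_apply_apply, innerSL_apply_apply,
        Complex.real_smul, Complex.real_smul, smul_eq_mul, smul_eq_mul, cpowGaussian_succ, ← hf, cLin_apply]
      ring
    have hint₁ := integrable_fourierSMulRight_cpowGaussian_apply e₁ e₂ m e₁
    have hint₂ := integrable_fourierSMulRight_cpowGaussian_apply e₁ e₂ m e₂
    have hL : 𝓕 (fourierSMulRight (innerSL ℝ) f) w e₁ + Complex.I * 𝓕 (fourierSMulRight (innerSL ℝ) f) w e₂ =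
        -(2 * π * Complex.I) * 𝓕 (cpowGaussian e₁ e₂ (m + 1)) w := by
      rw [hcoord e₁, hcoord e₂]
      have hsmul : 𝓕 (Complex.I • fun x ↦ fourierSMulRight (innerSL ℝ) f x e₂) w =
          Complex.I * 𝓕 (fun x ↦ fourierSMulRight (innerSL ℝ) f x e₂) w :=
        congrFun (fourierIntegral_const_smul 𝐞 volume (innerₗ V)
          (fun x ↦ fourierSMulRight (innerSL ℝ) f x e₂) Complex.I) w
      have hadd : 𝓕 ((fun x ↦ fourierSMulRight (innerSL ℝ) f x e₁) +
            Complex.I • (fun x ↦ fourierSMulRight (innerSL ℝ) f x e₂)) w =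
          𝓕 (fun x ↦ fourierSMulRight (innerSL ℝ) f x e₁) w +
            𝓕 (Complex.I • fun x ↦ fourierSMulRight (innerSL ℝ) f x e₂) w :=
        congrFun (fourierIntegral_add Real.continuous_fourierChar (by exact continuous_inner)
          hint₁ (hint₂.smul Complex.I)) w
      rw [← hsmul, ← hadd, hfun]
      exact congrFun (fourierIntegral_const_smul 𝐞 volume (innerₗ V)
        (cpowGaussian e₁ e₂ (m + 1)) (-(2 * π * Complex.I))) w
    -- the combination of the explicit derivatives is `(-i)^m (-2π) ℓ^{m+1} G` (holomorphy of `ℓ`)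
    have hR : 𝓕 (fourierSMulRight (innerSL ℝ) f) w e₁ + Complex.I * 𝓕 (fourierSMulRight (innerSL ℝ) f) w e₂ =
        (-Complex.I) ^ m * (-(2 * π) * cpowGaussian e₁ e₂ (m + 1) w) := by
      rw [hdir e₁, hdir e₂, cpowGaussian_succ, cpowGaussian_apply]
      set G : ℂ := ((Real.exp (-π * ‖w‖ ^ 2) : ℝ) : ℂ) with hGdef
      have hkey := cLin_self_add_I_mul_cLin_self h12 hnorm
      have hw : ((⟪w, e₁⟫ : ℝ) : ℂ) + Complex.I * ((⟪w, e₂⟫ : ℝ) : ℂ) = cLin e₁ e₂ w := by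
        rw [cLin_apply]; ring
      push_cast
      linear_combination ((-Complex.I) ^ m * (m : ℂ) * cLin e₁ e₂ w ^ (m - 1) * G) * hkey -
        ((-Complex.I) ^ m * (2 * π) * cLin e₁ e₂ w ^ m * G) * hw
    rw [hL] at hR
    -- solve for `𝓕[ℓ^{m+1} G](w)`
    have h2πI : -(2 * π * Complex.I) ≠ 0 := by
      simp [Real.pi_ne_zero, Complex.I_ne_zero]
    refine mul_left_cancel₀ h2πI ?_
    rw [hR, pow_succ]
    have hI : Complex.I * Complex.I = -1 := Complex.I_mul_I
    linear_combination (-((-Complex.I) ^ m * (2 * π) * cpowGaussian e₁ e₂ (m + 1) w)) * hI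

/-! ### Translates: decay and Fourier transform of `x ↦ ℓ(x + x₀)^m G(x + x₀)` -/

omit [FiniteDimensional ℝ V] [MeasurableSpace V] [BorelSpace V] in
/-- **Decay of the translated `ℓ^m G`**: `|ℓ(v + x₀)^m G(v + x₀)| ≤ C (1 + ‖v‖)^{-c}` for every `c ≥ 0`.
[cite: NeukirchANT1999, Ch. VII §3 (3.1)–(3.3) (proof steps)] -/
theorem norm_cpowGaussian_add_le (e₁ e₂ : V) (m : ℕ) (x₀ : V) {c : ℝ} (hc : 0 ≤ c) :
    ∃ C : ℝ, ∀ v : V, ‖cpowGaussian e₁ e₂ m (v + x₀)‖ ≤ C * (1 + ‖v‖) ^ (-c) := by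
  refine ⟨(‖e₁‖ + ‖e₂‖) ^ m * Real.exp (((m : ℝ) + c) ^ 2 / (4 * π)) * (1 + ‖x₀‖) ^ c, fun v ↦ ?_⟩
  have hA : 0 ≤ (‖e₁‖ + ‖e₂‖) ^ m := by positivity
  calc ‖cpowGaussian e₁ e₂ m (v + x₀)‖
      ≤ (‖e₁‖ + ‖e₂‖) ^ m * (‖v + x₀‖ ^ m * Real.exp (-π * ‖v + x₀‖ ^ 2)) :=
        norm_cpowGaussian_le e₁ e₂ m (v + x₀)
    _ ≤ (‖e₁‖ + ‖e₂‖) ^ m * (Real.exp (((m : ℝ) + c) ^ 2 / (4 * π)) * (1 + ‖v + x₀‖) ^ (-c)) :=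
        mul_le_mul_of_nonneg_left (norm_pow_mul_exp_le m hc (v + x₀)) hA
    _ ≤ (‖e₁‖ + ‖e₂‖) ^ m * (Real.exp (((m : ℝ) + c) ^ 2 / (4 * π)) *
          ((1 + ‖x₀‖) ^ c * (1 + ‖v‖) ^ (-c))) := by
        gcongr
        exact one_add_norm_add_rpow_neg_le hc v x₀
    _ = (‖e₁‖ + ‖e₂‖) ^ m * Real.exp (((m : ℝ) + c) ^ 2 / (4 * π)) * (1 + ‖x₀‖) ^ c *
          (1 + ‖v‖) ^ (-c) := by ring

omit [FiniteDimensional ℝ V] [MeasurableSpace V] [BorelSpace V] in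
/-- The translate `v ↦ ℓ(v + x₀)^m G(v + x₀)` is continuous. [cite: NeukirchANT1999, Ch. VII §3 (3.1)–(3.3) (proof steps)] -/
theorem continuous_cpowGaussian_add (e₁ e₂ : V) (m : ℕ) (x₀ : V) :
    Continuous fun v ↦ cpowGaussian e₁ e₂ m (v + x₀) :=
  (continuous_cpowGaussian e₁ e₂ m).comp (continuous_id.add continuous_const)

/-- **Fourier transform of the translate**: `𝓕[ℓ^m G(· + x₀)](ξ) = e^{2πi⟨x₀, ξ⟩} (-i)^m ℓ(ξ)^m G(ξ)` — Neukirch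
VII (3.3) Proposition, `f̂_p(a, b, ·) = [i^{Tr(p)} e^{2πi⟨a,b⟩}]⁻¹ f_p(-b, a, ·)`, in the case `a = x₀`, `b = 0`, for the
harmonic weight at one complex place; from `fourier_cpowGaussian` and translation ↦ phase (Mathlib
`VectorFourier.fourierIntegral_comp_add_right`). [cite: NeukirchANT1999, Ch. VII §3 (3.3) Proposition] -/
theorem fourier_cpowGaussian_add {e₁ e₂ : V} (h12 : ⟪e₁, e₂⟫ = 0) (hnorm : ‖e₁‖ = ‖e₂‖) (m : ℕ) (x₀ : V) :
    𝓕 (fun v ↦ cpowGaussian e₁ e₂ m (v + x₀)) =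
      fun w ↦ ((𝐞 ⟪x₀, w⟫ : ℂ)) * ((-Complex.I) ^ m * cpowGaussian e₁ e₂ m w) := by
  have h := VectorFourier.fourierIntegral_comp_add_right 𝐞 volume (innerₗ V) (cpowGaussian e₁ e₂ m) x₀
  have h2 := fourier_cpowGaussian h12 hnorm m
  funext w
  have hw := congrFun h w
  have h2w := congrFun h2 w
  change VectorFourier.fourierIntegral 𝐞 volume (innerₗ V) (cpowGaussian e₁ e₂ m) w = _ at h2w
  change VectorFourier.fourierIntegral 𝐞 volume (innerₗ V) (cpowGaussian e₁ e₂ m ∘ fun v ↦ v + x₀) w = _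
  rw [hw, h2w, innerₗ_apply_apply, Circle.smul_def, smul_eq_mul]

end Literature.NumberTheory.LFunctions.Fourier

end
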